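/-
Copyright (c) 2026 the pub-hodgecm-mathlib formalisation cell (harness21).  Prover seat hodgecm-mathlib-LH7-p09 (g0), re-dealt by director s1969 (a) to strike line L3
`stub_N6nsDyadic` (Track A «(D-RAM) FOUR-FRAME» squad F0∕P3c∕LH4); β₂-BOARD row (L-P) «populated cells: the cell's labelled difference vanishes» (holder LH7-p09 (g0); β₂
sub-dealer LH4-p04 (g8)); helper lane on h413 = stmt-HodgeConjecture-24833 (count-neutral).  Resumed in place after the hub outage 16:55Z–21:25Z.  2026-09-04.
-/
import Summits.HodgeConjecture.HodgeConjecture.Theorems.F0P3cDyRamCellDiffZero           -- ★ p861332 (this seat): `natCast_finsum_sub_eq_zero_of_exchange`, `natCast_ncard_sub_eq_zero_of_exchange`; brings ★ p861208 `finsum_mem_inter_eq_of_equiv_exchange`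
import Summits.HodgeConjecture.HodgeConjecture.Theorems.F0P3cDyRamConeCellFlipBalance      -- ★ p860839 + ED. 2 ★ p861174 (LH4-p09 (g9)): `smul_mem_levelSet[Dep]_iff_of_flip`, `smul_mem_levelSet[Dep]_iff_of_orderUnit`, `ne_zero_of_mul_map_eq`
import HarnessLib

/-!
# Crux `H413`, line LH4 «(D-RAM) FOUR-FRAME» — (β₂) road «PURE-CELL LEDGER» (R-36), row (L-P): THE TWO CELL SYMMETRIES IN `cellDiff` CURRENCY — a FLIP (`ε·Θε = ξ`, `ρξ = ξ`)
# or an ORDER-UNIT near-similitude (`ε·Θε = ν`, `ν·𝒪_j = 𝒪_j`) that exchanges the two labels and fixes the weight makes the cell's labelled difference vanish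

Cell `hodgecm-mathlib` (D-0151), FLOOR 0, crux item H413 = `stmt-HodgeConjecture-24833`, route `HCCMUnconditional`; squad F0∕P3c∕LH4.  THEOREMS ONLY (no `def`, no instance, no
notation, no `sorry`, default heartbeats); ★-only imports; lane `--supports stmt-HodgeConjecture-24833 --as helper` (count-neutral); pays NO tier-0 row, states NO law.
DATUM-FREE in the M-letters of ★ DEFS `F0P3cDyRamToricCensusDefs` (`levelSet ρ Θ α ϖE h j a`, `levelSetDep ρ Θ α ϖE h j a μ`); labels `P Q : AddSubgroup K → Prop`, weight `f`.

WHY.  In β₂-BOARD v1 (LH4-p04 (g8)) the (β₂) letter per literal is `Σ_cells [IsOrd_j lam]·cellDiff_t(j,b)` (★ p861305 `transvPlus_sub_cleanMinus_block_eq_cells`), with CONE cells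
`cellDiff(j,b) = (Σᶠ_{Λ ∈ levelSetDep(j,b;μ) ∩ {q₊}} f b j Λ : ℤ) − Σᶠ_{… ∩ {q₋}} f b j Λ` and AXIS cells `cellDiff(j,0) = (#(levelSet(j,0) ∩ {q₀₊}) : ℤ) − #(levelSet(j,0) ∩ {q₀₋})`.  Row
(L-P) = «every populated non-pure cell has `cellDiff = 0`», and the MECHANISM of record is a cell symmetry `Λ ↦ ε • Λ`: the ω-FLIP (`ε·Θε = ξ`, `ξ` a `ρ`-fixed non-norm unit — axis
cells and tube cells below the conductor, ★ p861154 ∕ ★ p861208) or an ORDER-UNIT near-similitude (`ε·Θε = ν`, `|ν| = 1`, `ν·𝒪_j = 𝒪_j`, `ρν = ν` NOT assumed — tube cells at and above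
the conductor, F0P3-p01's (M4-hi) column; label exchange ★ p862187 `valueSetMod_smul_xPlus_ne_of_two_mul_eq_of_not_exists_norm` (LH4-p09 (g9)), cell preservation ★ p861174 §3).
★ p861174 §3 gives the UNWEIGHTED order-unit transport (`ncard_levelSetDep_sep_eq_of_orderUnit_exchange`); the cone cells are WEIGHTED (`f b j Λ = #Sol_{2b}(r_Λ)`, ★ (C1)), and
the consumer's currency is the ℤ-cast difference.  THIS FILE closes that gap once, so that an (L-P) INSTANCE is exactly: ONE symmetry (`hε` + `hρξ`∕`hνO`) + the weight's
`ε`-invariance on the cell + the two label-exchange implications on the cell — nothing else: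
* §1 weighted transport `finsum_levelSetDep_inter_eq_of_orderUnit_exchange` (twin of ★ p861208 `…_of_flip_exchange`; any `AddCommMonoid` weight);
* §2 CONE cells: `natCast_finsum_levelSetDep_sub_eq_zero_of_orderUnit_exchange` ∕ `…_of_flip_exchange` (★ p861332 `natCast_finsum_sub_eq_zero_of_exchange`);
* §3 AXIS cells: `natCast_ncard_levelSet_sub_eq_zero_of_orderUnit_exchange` ∕ `…_of_flip_exchange` (★ p861332 `natCast_ncard_sub_eq_zero_of_exchange`), and the `levelSetDep`
  unweighted twins for cells read without the glue weight.
HONEST LABEL.  Count-neutral bookkeeping; which cells carry which symmetry, and the label exchange itself, are the instance files' business (★ p862187, ★ p861154, the engine's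
table); (β₂) ∕ `beta2Cells` stay HYPOTHESES; `HC_CM` is proved only modulo the 7 printed citations (2 remaining named inputs: hLiu418 = `stmt-HodgeConjecture-24832`, h413 =
`stmt-HodgeConjecture-24833`) until rung 0 closes.  Nothing printed is asserted.

## References
* [Kottwitz1986BaseChangeUnits] R. E. Kottwitz, *Base change for unit elements of Hecke algebras*, Compositio Math. 60 (1986), §1 pp. 240–241 (signed fixed-lattice counts, cell by cell).
* [LabesseLanglands1979] J.-P. Labesse, R. P. Langlands, *L-indistinguishability for SL(2)*, Canad. J. Math. 31 (1979), §2 p. 8 (sign-reversing involutions on labelled counts).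
* [Jacobowitz1962] R. Jacobowitz, *Hermitian forms over local fields*, Amer. J. Math. 84 (1962), §4 (similitudes of hermitian lattices).
* [Rogawski1990] J. D. Rogawski, *Automorphic Representations of Unitary Groups in Three Variables*, Ann. of Math. Stud. 123 (1990), §4.9 Prop. 4.9.1 (b) p. 55.
-/

set_option autoImplicit false

noncomputable section

namespace Summit.HodgeConjecture.HodgeConjecture.Cruxes.H413.F0P3cDyRamCellDiffZeroSymmetry

open scoped Pointwise WithZero
open Summit.HodgeConjecture.HodgeConjecture.Cruxes.H413.F0P3cDyRamToricCensusDefs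
open Summit.HodgeConjecture.HodgeConjecture.Cruxes.H413.F0P3cDyRamConeCellFlipBalance
open Summit.HodgeConjecture.HodgeConjecture.Cruxes.H413.F0P3cDyRamConeCellFaceTube (finsum_mem_inter_eq_of_equiv_exchange)
open Summit.HodgeConjecture.HodgeConjecture.Cruxes.H413.F0P3cDyRamCellDiffZero

variable {K : Type*} [Field K] [Valued K ℤᵐ⁰] {ρ Θ : K →+* K} {α : K}

/-! ## §0  The symmetry `Λ ↦ ε • Λ` as an `Equiv` of `AddSubgroup K` -/

omit [Valued K ℤᵐ⁰] in
/-- Scaling by a non-zero `ε` is a permutation of the additive subgroups of `K` (inverse: scaling by `ε⁻¹`). [cite: Jacobowitz1962, §4] -/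
theorem exists_equiv_smul {ε : K} (hε0 : ε ≠ 0) :
    ∃ τ : AddSubgroup K ≃ AddSubgroup K, (∀ Λ, τ Λ = ε • Λ) ∧ ∀ Λ, τ.symm Λ = ε⁻¹ • Λ :=
  ⟨⟨fun Λ => ε • Λ, fun Λ => ε⁻¹ • Λ, fun Λ => by simp only [smul_smul, inv_mul_cancel₀ hε0, one_smul],
      fun Λ => by simp only [smul_smul, mul_inv_cancel₀ hε0, one_smul]⟩, fun _ => rfl, fun _ => rfl⟩

/-! ## §1  Weighted two-label transport along an ORDER-UNIT symmetry of a depth cell (the weighted twin of ★ p861174 §3) -/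

/-- **WEIGHTED TWO-LABEL TRANSPORT ALONG AN ORDER-UNIT SYMMETRY.**  `ε·Θε = ν`, `|ν| = 1`, `ν·𝒪_j = 𝒪_j` (the letter `hνO`; `ρν = ν` NOT assumed), so `Λ ↦ ε • Λ` preserves
`levelSetDep ρ Θ α ϖE h j a μ` (★ p861174 `smul_mem_levelSetDep_iff_of_orderUnit`); if the weight `w` is `ε`-invariant on the cell and `ε` carries label `P` to `Q` (and `ε⁻¹` carries
`Q` back to `P`) on the cell, then `Σᶠ_{cell ∩ {P}} w = Σᶠ_{cell ∩ {Q}} w`. [cite: Kottwitz1986BaseChangeUnits, §1 pp. 240–241] [cite: Jacobowitz1962, §4] -/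
theorem finsum_levelSetDep_inter_eq_of_orderUnit_exchange {N : Type*} [AddCommMonoid N] {ε ν : K} (hε : ε * Θ ε = ν) (hν1 : Valued.v ν = 1)
    (ϖE h : K) (j a : ℕ) (μ : K) (hνO : ∀ y, IsOrd ρ α (ϖE ^ j) (ν * y) ↔ IsOrd ρ α (ϖE ^ j) y)
    (w : AddSubgroup K → N) (hw : ∀ Λ ∈ levelSetDep ρ Θ α ϖE h j a μ, w (ε • Λ) = w Λ) (P Q : AddSubgroup K → Prop)
    (hPQ : ∀ Λ ∈ levelSetDep ρ Θ α ϖE h j a μ, P Λ → Q (ε • Λ)) (hQP : ∀ Λ ∈ levelSetDep ρ Θ α ϖE h j a μ, Q Λ → P (ε⁻¹ • Λ)) :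
    ∑ᶠ Λ ∈ levelSetDep ρ Θ α ϖE h j a μ ∩ {Λ | P Λ}, w Λ = ∑ᶠ Λ ∈ levelSetDep ρ Θ α ϖE h j a μ ∩ {Λ | Q Λ}, w Λ := by
  have hν0 : ν ≠ 0 := fun h0 => by rw [h0, map_zero] at hν1; exact zero_ne_one hν1
  obtain ⟨τ, hτ, hτs⟩ := exists_equiv_smul (ne_zero_of_mul_map_eq hε hν0)
  refine finsum_mem_inter_eq_of_equiv_exchange _ τ (fun Λ => ?_) w (fun Λ hΛ => ?_) P Q (fun Λ hΛ hP => ?_) (fun Λ hΛ hQ => ?_)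
  · rw [hτ]; exact smul_mem_levelSetDep_iff_of_orderUnit hε hν1 ϖE h j a μ hνO Λ
  · rw [hτ]; exact hw Λ hΛ
  · rw [hτ]; exact hPQ Λ hΛ hP
  · rw [hτs]; exact hQP Λ hΛ hQ

/-! ## §2  CONE cells: the weighted `cellDiff` vanishes under either symmetry -/

/-- **ORDER-UNIT SYMMETRY ⇒ THE WEIGHTED CELL DIFFERENCE VANISHES** (tube cells at and above the conductor; F0P3-p01's (M4-hi) column, label exchange ★ p862187):
`((Σᶠ_{Λ ∈ cell ∩ {P}} f Λ : ℕ) : ℤ) − (Σᶠ_{Λ ∈ cell ∩ {Q}} f Λ : ℕ) = 0`, `cell = levelSetDep ρ Θ α ϖE h j a μ`.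
[cite: Kottwitz1986BaseChangeUnits, §1 pp. 240–241] [cite: LabesseLanglands1979, §2 p. 8] [cite: Jacobowitz1962, §4] -/
theorem natCast_finsum_levelSetDep_sub_eq_zero_of_orderUnit_exchange {ε ν : K} (hε : ε * Θ ε = ν) (hν1 : Valued.v ν = 1)
    (ϖE h : K) (j a : ℕ) (μ : K) (hνO : ∀ y, IsOrd ρ α (ϖE ^ j) (ν * y) ↔ IsOrd ρ α (ϖE ^ j) y)
    (f : AddSubgroup K → ℕ) (hf : ∀ Λ ∈ levelSetDep ρ Θ α ϖE h j a μ, f (ε • Λ) = f Λ) (P Q : AddSubgroup K → Prop)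
    (hPQ : ∀ Λ ∈ levelSetDep ρ Θ α ϖE h j a μ, P Λ → Q (ε • Λ)) (hQP : ∀ Λ ∈ levelSetDep ρ Θ α ϖE h j a μ, Q Λ → P (ε⁻¹ • Λ)) :
    ((∑ᶠ Λ ∈ levelSetDep ρ Θ α ϖE h j a μ ∩ {Λ | P Λ}, f Λ : ℕ) : ℤ) - ((∑ᶠ Λ ∈ levelSetDep ρ Θ α ϖE h j a μ ∩ {Λ | Q Λ}, f Λ : ℕ) : ℤ) = 0 := by
  rw [finsum_levelSetDep_inter_eq_of_orderUnit_exchange hε hν1 ϖE h j a μ hνO f hf P Q hPQ hQP, sub_self]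

/-- **FLIP SYMMETRY ⇒ THE WEIGHTED CELL DIFFERENCE VANISHES** (`ε·Θε = ξ`, `ρξ = ξ`, `|ξ| = 1` — the ω-flip of the axis ∕ low-tube cells, ★ p860839 `smul_mem_levelSetDep_iff_of_flip`):
`((Σᶠ_{cell ∩ {P}} f : ℕ) : ℤ) − (Σᶠ_{cell ∩ {Q}} f : ℕ) = 0`. [cite: Kottwitz1986BaseChangeUnits, §1 pp. 240–241] [cite: LabesseLanglands1979, §2 p. 8] -/
theorem natCast_finsum_levelSetDep_sub_eq_zero_of_flip_exchange {ε ξ : K} (hε : ε * Θ ε = ξ) (hρξ : ρ ξ = ξ) (hξ1 : Valued.v ξ = 1)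
    (ϖE h : K) (j a : ℕ) (μ : K)
    (f : AddSubgroup K → ℕ) (hf : ∀ Λ ∈ levelSetDep ρ Θ α ϖE h j a μ, f (ε • Λ) = f Λ) (P Q : AddSubgroup K → Prop)
    (hPQ : ∀ Λ ∈ levelSetDep ρ Θ α ϖE h j a μ, P Λ → Q (ε • Λ)) (hQP : ∀ Λ ∈ levelSetDep ρ Θ α ϖE h j a μ, Q Λ → P (ε⁻¹ • Λ)) :
    ((∑ᶠ Λ ∈ levelSetDep ρ Θ α ϖE h j a μ ∩ {Λ | P Λ}, f Λ : ℕ) : ℤ) - ((∑ᶠ Λ ∈ levelSetDep ρ Θ α ϖE h j a μ ∩ {Λ | Q Λ}, f Λ : ℕ) : ℤ) = 0 := by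
  have hξ0 : ξ ≠ 0 := fun h0 => by rw [h0, map_zero] at hξ1; exact zero_ne_one hξ1
  obtain ⟨τ, hτ, hτs⟩ := exists_equiv_smul (ne_zero_of_mul_map_eq hε hξ0)
  refine natCast_finsum_sub_eq_zero_of_exchange _ τ (fun Λ => ?_) f (fun Λ hΛ => ?_) P Q (fun Λ hΛ hP => ?_) (fun Λ hΛ hQ => ?_)
  · rw [hτ]; exact smul_mem_levelSetDep_iff_of_flip hε hρξ hξ1 ϖE h j a μ Λ
  · rw [hτ]; exact hf Λ hΛ
  · rw [hτ]; exact hPQ Λ hΛ hP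
  · rw [hτs]; exact hQP Λ hΛ hQ

/-- **UNWEIGHTED CONE CELL, ORDER-UNIT SYMMETRY**: `(#(cell ∩ {P}) : ℤ) − #(cell ∩ {Q}) = 0` on `levelSetDep` (cells read without the glue weight).
[cite: Kottwitz1986BaseChangeUnits, §1 pp. 240–241] [cite: Jacobowitz1962, §4] -/
theorem natCast_ncard_levelSetDep_sub_eq_zero_of_orderUnit_exchange {ε ν : K} (hε : ε * Θ ε = ν) (hν1 : Valued.v ν = 1)
    (ϖE h : K) (j a : ℕ) (μ : K) (hνO : ∀ y, IsOrd ρ α (ϖE ^ j) (ν * y) ↔ IsOrd ρ α (ϖE ^ j) y) (P Q : AddSubgroup K → Prop)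
    (hPQ : ∀ Λ ∈ levelSetDep ρ Θ α ϖE h j a μ, P Λ → Q (ε • Λ)) (hQP : ∀ Λ ∈ levelSetDep ρ Θ α ϖE h j a μ, Q Λ → P (ε⁻¹ • Λ)) :
    ((levelSetDep ρ Θ α ϖE h j a μ ∩ {Λ | P Λ}).ncard : ℤ) - ((levelSetDep ρ Θ α ϖE h j a μ ∩ {Λ | Q Λ}).ncard : ℤ) = 0 := by
  have hν0 : ν ≠ 0 := fun h0 => by rw [h0, map_zero] at hν1; exact zero_ne_one hν1
  obtain ⟨τ, hτ, hτs⟩ := exists_equiv_smul (ne_zero_of_mul_map_eq hε hν0)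
  refine natCast_ncard_sub_eq_zero_of_exchange _ τ (fun Λ => ?_) P Q (fun Λ hΛ hP => ?_) (fun Λ hΛ hQ => ?_)
  · rw [hτ]; exact smul_mem_levelSetDep_iff_of_orderUnit hε hν1 ϖE h j a μ hνO Λ
  · rw [hτ]; exact hPQ Λ hΛ hP
  · rw [hτs]; exact hQP Λ hΛ hQ

/-! ## §3  AXIS cells (`levelSet`, plain counts) under either symmetry -/

/-- **ORDER-UNIT SYMMETRY ⇒ THE AXIS CELL DIFFERENCE VANISHES**: `(#(levelSet… ∩ {P}) : ℤ) − #(levelSet… ∩ {Q}) = 0` (★ p861174 `smul_mem_levelSet_iff_of_orderUnit`).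
[cite: Kottwitz1986BaseChangeUnits, §1 pp. 240–241] [cite: Jacobowitz1962, §4] -/
theorem natCast_ncard_levelSet_sub_eq_zero_of_orderUnit_exchange {ε ν : K} (hε : ε * Θ ε = ν) (hν1 : Valued.v ν = 1)
    (ϖE h : K) (j a : ℕ) (hνO : ∀ y, IsOrd ρ α (ϖE ^ j) (ν * y) ↔ IsOrd ρ α (ϖE ^ j) y) (P Q : AddSubgroup K → Prop)
    (hPQ : ∀ Λ ∈ levelSet ρ Θ α ϖE h j a, P Λ → Q (ε • Λ)) (hQP : ∀ Λ ∈ levelSet ρ Θ α ϖE h j a, Q Λ → P (ε⁻¹ • Λ)) :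
    ((levelSet ρ Θ α ϖE h j a ∩ {Λ | P Λ}).ncard : ℤ) - ((levelSet ρ Θ α ϖE h j a ∩ {Λ | Q Λ}).ncard : ℤ) = 0 := by
  have hν0 : ν ≠ 0 := fun h0 => by rw [h0, map_zero] at hν1; exact zero_ne_one hν1
  obtain ⟨τ, hτ, hτs⟩ := exists_equiv_smul (ne_zero_of_mul_map_eq hε hν0)
  refine natCast_ncard_sub_eq_zero_of_exchange _ τ (fun Λ => ?_) P Q (fun Λ hΛ hP => ?_) (fun Λ hΛ hQ => ?_)
  · rw [hτ]; exact smul_mem_levelSet_iff_of_orderUnit hε hν1 ϖE h j a hνO Λ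
  · rw [hτ]; exact hPQ Λ hΛ hP
  · rw [hτs]; exact hQP Λ hΛ hQ

/-- **FLIP SYMMETRY ⇒ THE AXIS CELL DIFFERENCE VANISHES** (`ε·Θε = ξ`, `ρξ = ξ`, `|ξ| = 1`; ★ p860839 `smul_mem_levelSet_iff_of_flip`) — the (AX)∕(AX-0) shape in `cellDiff` currency.
[cite: Kottwitz1986BaseChangeUnits, §1 pp. 240–241] [cite: LabesseLanglands1979, §2 p. 8] -/
theorem natCast_ncard_levelSet_sub_eq_zero_of_flip_exchange {ε ξ : K} (hε : ε * Θ ε = ξ) (hρξ : ρ ξ = ξ) (hξ1 : Valued.v ξ = 1)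
    (ϖE h : K) (j a : ℕ) (P Q : AddSubgroup K → Prop)
    (hPQ : ∀ Λ ∈ levelSet ρ Θ α ϖE h j a, P Λ → Q (ε • Λ)) (hQP : ∀ Λ ∈ levelSet ρ Θ α ϖE h j a, Q Λ → P (ε⁻¹ • Λ)) :
    ((levelSet ρ Θ α ϖE h j a ∩ {Λ | P Λ}).ncard : ℤ) - ((levelSet ρ Θ α ϖE h j a ∩ {Λ | Q Λ}).ncard : ℤ) = 0 := by
  have hξ0 : ξ ≠ 0 := fun h0 => by rw [h0, map_zero] at hξ1; exact zero_ne_one hξ1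
  obtain ⟨τ, hτ, hτs⟩ := exists_equiv_smul (ne_zero_of_mul_map_eq hε hξ0)
  refine natCast_ncard_sub_eq_zero_of_exchange _ τ (fun Λ => ?_) P Q (fun Λ hΛ hP => ?_) (fun Λ hΛ hQ => ?_)
  · rw [hτ]; exact smul_mem_levelSet_iff_of_flip hε hρξ hξ1 ϖE h j a Λ
  · rw [hτ]; exact hPQ Λ hΛ hP
  · rw [hτs]; exact hQP Λ hΛ hQ

end Summit.HodgeConjecture.HodgeConjecture.Cruxes.H413.F0P3cDyRamCellDiffZeroSymmetry

end
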